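import Mathlib
import Literature.AlgebraicGeometry.Resolution.FiniteExtensionUniformizationProofs
import HarnessLib

/-!
# Knaf–Kuhlmann 2005, Cor. 2.2 sharpened for a `K`-trivial Abhyankar place: the value group has a ℤ-BASIS of values of elements of `F`

Route `RadicialJung`, crux `CleanModels` (stmt-ResolutionOfSingularities-15917), line `Sketch` rev 35; explicit-unit seat `decomp-res-hand-1` g3.
GROUNDWORK (lemma M1 of `Cruxes/CleanModels/Lines/Sketch-memo-hand1-g3.md` §4) for the discharge of the printed input
`Literature.AlgebraicGeometry.Resolution.KnafKuhlmann2005_Thm11_monomialForm` (Knaf–Kuhlmann 2005 Thm. 1.1 WITH its monomial clause; consumer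
✓ p793208, the Abhyankar column of stub 7 over perfect ground fields): Knaf–Kuhlmann's bookkeeping for the «Moreover» clause (p. 13) starts from
elements `x₁,…,x_r ∈ F` whose values form a ℤ-BASIS of `v F` (Thm. 3.4 (a)), so that every non-zero `ζ` has `v ζ = v(x^m)` for a unique `m ∈ ℤ^r`.
The tree's PROVED `KnafKuhlmann2005_Cor22_holds` gives finitely many values GENERATING `v F` modulo `v K`; the tree's `IsAbhyankarPlace` /
`KnafKuhlmann2005_Thm34_etale` give INDEPENDENT values.  This file supplies both at once for a `K`-trivial place (`K ⊆ 𝒪_V`, so `v K = 1`):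
the subgroup of the (torsion-free, linearly ordered) value group generated by the Cor. 2.2 generators is finitely generated free, and a ℤ-basis of
it is realised by Laurent monomials in the generators.

* `valuation_eq_one_of_mem_subfield` — a `K`-trivial place has `v b = 1` on `K ∖ {0}`.
* `exists_valueBasis_of_isAbhyankarPlace` — for `K ≤ F` finitely generated, `K ⊆ V`, `V` Abhyankar on `F|K`: there are `x : Fin r → F`, non-zero,
  with `∏ v(xᵢ)^{mᵢ} = 1 → m = 0` and `∀ a ∈ F, a ≠ 0 → ∃ m, v a = ∏ v(xᵢ)^{mᵢ}`.

OURS (elementary ℤ-linear algebra over the landed Cor. 2.2); proves nothing about resolution of singularities in characteristic `p`. counted 0.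
-/

noncomputable section

set_option linter.dupNamespace false -- mandated namespace of this single-conjunct summit

open IsLocalRing
open Literature.AlgebraicGeometry.Resolution

namespace Summit.ResolutionOfSingularities.ResolutionOfSingularities.Theorems.RadicialJung.CleanModels

namespace KK05ValueBasis

universe u

variable {Ω : Type u} [Field Ω]

/-- A `K`-trivial place takes the value `1` on the non-zero elements of `K`. [folklore] -/
theorem valuation_eq_one_of_mem_subfield (V : ValuationSubring Ω) (K : Subfield Ω) (hKV : (K : Set Ω) ⊆ V)
    {b : Ω} (hb : b ∈ K) (hb0 : b ≠ 0) : V.valuation b = 1 := by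
  have h1 : V.valuation b ≤ 1 := (V.valuation_le_one_iff b).mpr (hKV hb)
  have h2 : V.valuation b⁻¹ ≤ 1 := (V.valuation_le_one_iff _).mpr (hKV (inv_mem hb))
  rw [map_inv₀] at h2
  have hvb0 : V.valuation b ≠ 0 := (map_ne_zero V.valuation).mpr hb0
  have h3 : 1 ≤ V.valuation b := by
    rwa [inv_le_one₀ (zero_lt_iff.mpr hvb0)] at h2
  exact le_antisymm h1 h3

/-- **A ℤ-basis of the value group of a `K`-trivial Abhyankar place, realised in `F`** (Knaf–Kuhlmann 2005, Thm. 3.4 (a) / Cor. 2.2: "if `P` is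
trivial on `K`, then `v_P F` is a product of finitely many copies of `ℤ`").  For `K ≤ F ⊆ Ω` with `F|K` finitely generated, `K ⊆ 𝒪_V` and `V`
an Abhyankar place of `F|K`, there are non-zero `x₁,…,x_r ∈ F` whose values are ℤ-linearly independent and such that every non-zero `a ∈ F` has
`v a = ∏ v(xᵢ)^{mᵢ}` for some `m ∈ ℤ^r`.  From the tree's `KnafKuhlmann2005_Cor22_holds` by ℤ-linear algebra in the torsion-free value group.
[cite: KnafKuhlmann2005, Cor. 2.2 and Thm. 3.4 (a)] -/
theorem exists_valueBasis_of_isAbhyankarPlace (V : ValuationSubring Ω) (K F : Subfield Ω) (hKF : K ≤ F)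
    (hfg : FGOver K F) (hKV : (K : Set Ω) ⊆ V) (hA : IsAbhyankarPlace V K F) :
    ∃ (r : ℕ) (x : Fin r → Ω), (∀ i, x i ∈ F ∧ x i ≠ 0) ∧
      (∀ m : Fin r → ℤ, (∏ i, V.valuation (x i) ^ (m i)) = 1 → m = 0) ∧
      ∀ a ∈ F, a ≠ 0 → ∃ m : Fin r → ℤ, V.valuation a = ∏ i, V.valuation (x i) ^ (m i) := by
  classical
  obtain ⟨⟨ρ, x₀, hx₀F, hgen⟩, -⟩ := KnafKuhlmann2005_Cor22_holds Ω V K F hKF hfg hA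
  have hx₀0 : ∀ i, x₀ i ≠ 0 := fun i => (hx₀F i).2
  have hv0 : ∀ i, V.valuation (x₀ i) ≠ 0 := fun i => (map_ne_zero V.valuation).mpr (hx₀0 i)
  -- the generators as elements of the additive group `A` of units of the value group
  let G := (V.ValueGroup)ˣ
  let g : Fin ρ → Additive G := fun i => Additive.ofMul (Units.mk0 (V.valuation (x₀ i)) (hv0 i))
  let N : Submodule ℤ (Additive G) := Submodule.span ℤ (Set.range g)
  haveI : Module.Finite ℤ N := Module.Finite.span_of_finite ℤ (Set.finite_range g)
  haveI : Module.Free ℤ N := Module.free_of_finite_type_torsion_free'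
  let ι := Module.Free.ChooseBasisIndex ℤ N
  let bN : Module.Basis ι ℤ N := Module.Free.chooseBasis ℤ N
  haveI : Fintype ι := Module.Free.ChooseBasisIndex.fintype ℤ N
  -- each basis vector is a ℤ-combination of the generators
  have hmem : ∀ j : ι, ((bN j : N) : Additive G) ∈ Submodule.span ℤ (Set.range g) := fun j => (bN j).2
  choose e he using fun j => (Submodule.mem_span_range_iff_exists_fun ℤ).mp (hmem j)
  -- he j : ∑ i, e j i • g i = bN j
  let r := Fintype.card ι
  let σ : Fin r ≃ ι := (Fintype.equivFin ι).symm
  let x : Fin r → Ω := fun j => ∏ i, x₀ i ^ (e (σ j) i)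
  have hxF : ∀ j, x j ∈ F := fun j => prod_mem fun i _ => zpow_mem (hx₀F i).1 _
  have hx0 : ∀ j, x j ≠ 0 := fun j => Finset.prod_ne_zero_iff.mpr fun i _ => zpow_ne_zero _ (hx₀0 i)
  have hvx : ∀ j, V.valuation (x j) = ∏ i, V.valuation (x₀ i) ^ (e (σ j) i) := fun j => by
    simp only [x, map_prod, map_zpow₀]
  -- the value of `x j` as a unit is the basis vector `bN (σ j)`
  have hunit : ∀ j, (Units.mk0 (V.valuation (x j)) ((map_ne_zero V.valuation).mpr (hx0 j)) : G) =
      Additive.toMul ((bN (σ j) : N) : Additive G) := by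
    intro j
    rw [← he (σ j)]
    ext
    rw [Units.val_mk0, hvx j, toMul_sum, Units.coe_prod]
    refine Finset.prod_congr rfl fun i _ => ?_
    rw [toMul_zsmul, Units.val_zpow_eq_zpow_val]
    rfl
  refine ⟨r, x, fun j => ⟨hxF j, hx0 j⟩, ?_, ?_⟩
  · -- independence
    intro m hm
    have hsum : (∑ j, m j • (bN (σ j) : N)) = 0 := by
      apply Subtype.ext
      rw [Submodule.coe_sum, Submodule.coe_zero]
      apply Additive.toMul.injective
      rw [toMul_sum, toMul_zero]
      apply Units.ext
      rw [Units.coe_prod, Units.val_one, ← hm]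
      refine Finset.prod_congr rfl fun j _ => ?_
      rw [Submodule.coe_smul, toMul_zsmul, Units.val_zpow_eq_zpow_val, ← hunit j, Units.val_mk0]
    have hli := bN.linearIndependent
    have hm' : ∀ j, m j = 0 := by
      have := Fintype.linearIndependent_iff.mp (hli.comp σ σ.injective) m hsum
      exact this
    funext j
    exact hm' j
  · -- generation
    intro a ha ha0
    obtain ⟨m, b, hb, hab⟩ := hgen a ha ha0
    have hb0 : b ≠ 0 := by
      rintro rfl
      rw [map_zero, zero_mul] at hab
      exact (map_ne_zero V.valuation).mpr ha0 hab
    rw [valuation_eq_one_of_mem_subfield V K hKV hb hb0, one_mul] at hab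
    have hva0 : V.valuation a ≠ 0 := (map_ne_zero V.valuation).mpr ha0
    -- `v a` as an element of `N`
    have haN : Additive.ofMul (Units.mk0 (V.valuation a) hva0) ∈ N := by
      have : Additive.ofMul (Units.mk0 (V.valuation a) hva0) = ∑ i, m i • g i := by
        apply Additive.toMul.injective
        apply Units.ext
        rw [toMul_ofMul, Units.val_mk0, hab, toMul_sum, Units.coe_prod]
        refine Finset.prod_congr rfl fun i _ => ?_
        rw [toMul_zsmul, Units.val_zpow_eq_zpow_val]
        rfl
      rw [this]
      exact Submodule.sum_mem _ fun i _ => Submodule.smul_mem _ _ (Submodule.subset_span ⟨i, rfl⟩)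
    set n : N := ⟨_, haN⟩ with hn
    have hrepr := bN.sum_repr n
    refine ⟨fun j => bN.repr n (σ j), ?_⟩
    have hval : (n : Additive G) = ∑ j : Fin r, (bN.repr n (σ j)) • ((bN (σ j) : N) : Additive G) := by
      conv_lhs => rw [← hrepr]
      rw [Submodule.coe_sum]
      rw [← σ.sum_comp (fun i => ((bN.repr n i • bN i : N) : Additive G))]
      rfl
    have := congrArg (fun t : Additive G => ((Additive.toMul t : G) : V.ValueGroup)) hval
    rw [hn, toMul_ofMul, Units.val_mk0] at this
    rw [this, toMul_sum, Units.coe_prod]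
    refine Finset.prod_congr rfl fun j _ => ?_
    rw [toMul_zsmul, Units.val_zpow_eq_zpow_val, ← hunit j, Units.val_mk0]

end KK05ValueBasis

end Summit.ResolutionOfSingularities.ResolutionOfSingularities.Theorems.RadicialJung.CleanModels

end
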